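import Mathlib
import HarnessLib
import Summits.Ventures.LatticeQCDFlow.Exactness.LaggedAdaptationJointLaw

/-!
# LatticeQCDFlow / Exactness — LEARNING ON THE JOB, XVII: THE GENERAL LAG THEOREM — if every parameter used in the last `n` updates is a
# function of the same information `I` (however correlated with the configuration when `I` was collected), the configuration ends within
# `(1 − ε)ⁿ` of `π`, and jointly with `I` within `(1 − ε)ⁿ` of `Law(I) ⊗ π`

HONEST FRAMING: exact (Metropolis-corrected) sampling algorithms for lattice gauge theory;
figures of merit are autocorrelation/cost numbers at stated couplings and volumes; no
continuum-physics claim.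

Venture `LatticeQCDFlow` (cell pub-lqcd), topic `Exactness`, FANOUT row 30 (lean-1 GEN-44, theme LEARNING ON THE JOB).  NEW WORK of the
cell; no definition is introduced, nothing is cited as a fact.  Tree inputs: `LaggedAdaptationJointLaw` (the one-kernel case and its lemmas
`frozenStep_prod_invariant`, `frozenStep_map_fst`, `frozenStep_minorised`, `measure_add_right_cancel`), `LaggedAdaptationDoeblin`
(`bindKernel_add_measure`).  `LaggedAdaptationJointLaw` froze ONE parameter for `n` steps (epoch-wise retraining); a run with lag `n` uses at
step `s` parameters computed from information up to `s − n`, so the `n` steps ending at time `t` all use functions of the information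
`I = I_{t−n}` — DIFFERENT functions at different steps.  This file carries the split through a LIST of information-frozen steps.

## Setting
`π` a probability on `Ω`; an information space `H` (everything recorded up to the lag horizon); a SCHEDULE `Js : List (Kernel (H × Ω) (H × Ω))`
of information-frozen steps, each satisfying the three abstract properties of a frozen exact `ε`-Doeblin step (`LaggedAdaptationJointLaw` §1):
(P) every product `m ⊗ π` is invariant; (F) the information marginal never moves; (M) `ε·((r.map fst) ⊗ π) ≤ rJ` for every measure `r`.
`frozenInfoStep_props` discharges (P)(F)(M) for the step "move the configuration by `κ(G(I), x)`" — the flow sampler with parameters `G(I)`,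
any measurable `G` (the training rule read at that step).  `ρ` any probability on `H × Ω` (information and configuration, any dependence).

## Results (no `sorry`)
* §1 `frozenInfoStep_props` — (P)(F)(M) for `Ĵ_G(I, x)(C) = κ(G(I), x){y | (I, y) ∈ C}` from `π`-exact `ε`-minorised sections of `κ`.
* §2 **`infoSchedule_split`** — for every schedule satisfying (P)(F)(M): `ρJ₁⋯Jₙ + (1 − ε)ⁿ·(ρ_H ⊗ π) = ρ_H ⊗ π + r` with `r.map fst = (1 − ε)ⁿ·ρ_H`
  (induction from the right end of the list).
* §3 **`infoSchedule_joint_real_sub_le`** — `|ρJ₁⋯Jₙ(C) − (ρ_H ⊗ π)(C)| ≤ (1 − ε)ⁿ` for every `C`; **`infoSchedule_config_real_sub_le`** — the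
  configuration after the `n` steps is within `(1 − ε)ⁿ` of `π`; **`infoSchedule_dominates`** — `(1 − (1 − ε)ⁿ)·(ρ_H ⊗ π) ≤ ρJ₁⋯Jₙ`.
* §4 **`laggedTraining_config_real_sub_le`** — THE LAG THEOREM FOR FLOW SAMPLERS: parameters `G₁(I), …, Gₙ(I)` (any measurable training rules
  applied to the lag-horizon information) driving a flow sampler with `π`-exact `ε`-Doeblin sections: from ANY joint law of `(I, x)`, the configuration
  after the `n` steps is within `(1 − ε)ⁿ` of `π` on every set.
-/

namespace Summit.Ventures.LatticeQCDFlow.Exactness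

open MeasureTheory ProbabilityTheory
open scoped _root_.ENNReal

variable {Ω H : Type*} [MeasurableSpace Ω] [MeasurableSpace H] {π : Measure Ω} [IsProbabilityMeasure π]

/-! ## §1 An information-frozen step with a training rule `G` -/

/-- **(P)(F)(M) FOR THE STEP WITH PARAMETERS `G(I)`**: with `H'` the parameter space, `κ : Kernel (H' × Ω) Ω` Markov with `π`-exact sections and
`ε·π ≤ κ`, and `G : H → H'` measurable, any kernel `Ĵ` with `Ĵ(I, x)(C) = κ(G I, x){y | (I, y) ∈ C}` preserves every `m ⊗ π`, keeps the information
marginal, and satisfies `ε·((r.map fst) ⊗ π) ≤ rĴ`. [ours] -/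
theorem frozenInfoStep_props {H' : Type*} [MeasurableSpace H'] (κ : Kernel (H' × Ω) Ω) [IsMarkovKernel κ]
    (hκ : ∀ (h : H') {B : Set Ω}, MeasurableSet B → ∫⁻ x, κ (h, x) B ∂π = π B) {ε : ℝ≥0∞}
    (hmin : ∀ (h : H') (x : Ω) {B : Set Ω}, MeasurableSet B → ε * π B ≤ κ (h, x) B) {G : H → H'} (hG : Measurable G)
    (J : Kernel (H × Ω) (H × Ω)) (hJ : ∀ (I : H) (x : Ω) {C : Set (H × Ω)}, MeasurableSet C → J (I, x) C = κ (G I, x) ((fun y => (I, y)) ⁻¹' C)) :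
    (∀ m : Measure H, (m.prod π).bind J = m.prod π) ∧ (∀ μ : Measure (H × Ω), (μ.bind J).map Prod.fst = μ.map Prod.fst) ∧
      ∀ (r : Measure (H × Ω)) {C : Set (H × Ω)}, MeasurableSet C → ε * ((r.map Prod.fst).prod π) C ≤ (r.bind J) C := by
  -- the step is the frozen step of the re-parametrised kernel `κ_G(I, x) = κ(G I, x)`
  let κG : Kernel (H × Ω) Ω := κ.comap (Prod.map G id) (hG.prodMap measurable_id)
  haveI : IsMarkovKernel κG := by
    refine ⟨fun p => ⟨?_⟩⟩
    rw [Kernel.comap_apply]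
    exact measure_univ
  have hκG : ∀ (I : H) {B : Set Ω}, MeasurableSet B → ∫⁻ x, κG (I, x) B ∂π = π B := fun I B hB => by
    simp_rw [κG, Kernel.comap_apply, Prod.map_apply, id]
    exact hκ (G I) hB
  have hminG : ∀ (I : H) (x : Ω) {B : Set Ω}, MeasurableSet B → ε * π B ≤ κG (I, x) B := fun I x B hB => by
    rw [Kernel.comap_apply, Prod.map_apply, id]
    exact hmin (G I) x hB
  have hJG : ∀ (I : H) (x : Ω) {C : Set (H × Ω)}, MeasurableSet C → J (I, x) C = κG (I, x) ((fun y => (I, y)) ⁻¹' C) :=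
    fun I x C hC => by rw [hJ I x hC, Kernel.comap_apply, Prod.map_apply, id]
  exact ⟨fun m => frozenStep_prod_invariant κG J hJG hκG m, fun μ => frozenStep_map_fst κG J hJG μ,
    fun r C hC => frozenStep_minorised κG J hJG hminG r hC⟩

/-! ## §2 The split for a schedule of information-frozen steps -/

/-- **THE SPLIT FOR A SCHEDULE**: if every member of `Js` satisfies (P)(F)(M), then for every probability `ρ` on `H × Ω` there is a measure `r` with
`ρJ₁⋯Jₙ + (1 − ε)ⁿ·(ρ_H ⊗ π) = ρ_H ⊗ π + r` and `r.map fst = (1 − ε)ⁿ·ρ_H`. [ours] -/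
theorem infoSchedule_split {ε : ℝ≥0∞} (hε1 : ε ≤ 1) (Js : List (Kernel (H × Ω) (H × Ω)))
    (hP : ∀ J ∈ Js, ∀ m : Measure H, (m.prod π).bind J = m.prod π)
    (hF : ∀ J ∈ Js, ∀ μ : Measure (H × Ω), (μ.bind J).map Prod.fst = μ.map Prod.fst)
    (hM : ∀ J ∈ Js, ∀ (r : Measure (H × Ω)) {C : Set (H × Ω)}, MeasurableSet C → ε * ((r.map Prod.fst).prod π) C ≤ (r.bind J) C)
    (ρ : Measure (H × Ω)) [IsProbabilityMeasure ρ] :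
    ∃ r : Measure (H × Ω),
      Js.foldl (fun (μ : Measure (H × Ω)) (J : Kernel (H × Ω) (H × Ω)) => μ.bind J) ρ + (1 - ε) ^ Js.length • ((ρ.map Prod.fst).prod π) =
          (ρ.map Prod.fst).prod π + r ∧
        r.map Prod.fst = (1 - ε) ^ Js.length • ρ.map Prod.fst := by
  haveI : IsProbabilityMeasure (ρ.map (Prod.fst : H × Ω → H)) := Measure.isProbabilityMeasure_map measurable_fst.aemeasurable
  set ρH : Measure H := ρ.map Prod.fst with hρH
  set P : Measure (H × Ω) := ρH.prod π with hPdef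
  have hPfst : P.map Prod.fst = ρH := by rw [hPdef, Measure.map_fst_prod, measure_univ, one_smul]
  have h1ε : (1 - ε) + ε = 1 := tsub_add_cancel_of_le hε1
  induction Js using List.reverseRecOn with
  | nil => exact ⟨ρ, by simp [add_comm], by simp [hρH]⟩
  | append_singleton Js J ih =>
    obtain ⟨r, hr, hrH⟩ := ih (fun J' hJ' => hP J' (List.mem_append_left _ hJ')) (fun J' hJ' => hF J' (List.mem_append_left _ hJ'))
      (fun J' hJ' => hM J' (List.mem_append_left _ hJ'))
    have hJmem : J ∈ Js ++ [J] := List.mem_append_right _ (List.mem_singleton_self J)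
    set c : ℝ≥0∞ := (1 - ε) ^ Js.length with hc
    have hc1 : c ≤ 1 := pow_le_one₀ (zero_le) tsub_le_self
    have hεc : ε * c ≠ ⊤ := ENNReal.mul_ne_top (ne_top_of_le_ne_top ENNReal.one_ne_top hε1) (ne_top_of_le_ne_top ENNReal.one_ne_top hc1)
    haveI : IsFiniteMeasure ((ε * c) • P) :=
      ⟨by rw [Measure.smul_apply, smul_eq_mul, measure_univ, mul_one]; exact hεc.lt_top⟩
    haveI : IsFiniteMeasure ((ε * c) • ρH) :=
      ⟨by rw [Measure.smul_apply, smul_eq_mul, measure_univ, mul_one]; exact hεc.lt_top⟩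
    have hPinv : P.bind J = P := hP J hJmem ρH
    -- one more step applied to the split
    have hstep : (Js ++ [J]).foldl (fun (μ : Measure (H × Ω)) (J : Kernel (H × Ω) (H × Ω)) => μ.bind J) ρ + c • P = P + r.bind J := by
      have := congrArg (fun ν : Measure (H × Ω) => ν.bind J) hr
      simp only [bindKernel_add_measure, Measure.bind_smul, hPinv] at this
      rw [List.foldl_append, List.foldl_cons, List.foldl_nil]
      exact this
    have hdom : (ε * c) • P ≤ r.bind J := by
      refine Measure.le_iff.2 fun C hC => ?_
      rw [Measure.smul_apply, smul_eq_mul, mul_assoc]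
      have h := hM J hJmem r hC
      rwa [hrH, Measure.prod_smul_left, Measure.smul_apply, smul_eq_mul] at h
    have hlen : (Js ++ [J]).length = Js.length + 1 := by rw [List.length_append, List.length_singleton]
    refine ⟨r.bind J - (ε * c) • P, ?_, ?_⟩
    · have hsplitc : c • P = ((1 - ε) * c) • P + (ε * c) • P := by rw [← add_smul, ← add_mul, h1ε, one_mul]
      refine measure_add_right_cancel (ν := (ε * c) • P) ?_
      rw [hlen, pow_succ, mul_comm _ (1 - ε), add_assoc, ← hsplitc, hstep, add_assoc, Measure.sub_add_cancel_of_le hdom]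
    · have hfst : (r.bind J).map Prod.fst = c • ρH := by rw [hF J hJmem, hrH]
      have hdecomp : (r.bind J).map Prod.fst = (r.bind J - (ε * c) • P).map Prod.fst + (ε * c) • ρH := by
        conv_lhs => rw [← Measure.sub_add_cancel_of_le hdom]
        rw [Measure.map_add _ _ measurable_fst, Measure.map_smul, hPfst]
      have hsplitc : c • ρH = ((1 - ε) * c) • ρH + (ε * c) • ρH := by rw [← add_smul, ← add_mul, h1ε, one_mul]
      refine measure_add_right_cancel (ν := (ε * c) • ρH) ?_
      rw [← hdecomp, hfst, hlen, pow_succ, mul_comm _ (1 - ε), ← hsplitc]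

/-! ## §3 The bounds for a schedule -/

/-- **DOMINATION**: `(1 − (1 − ε)ⁿ)·(ρ_H ⊗ π) ≤ ρJ₁⋯Jₙ`. [ours] -/
theorem infoSchedule_dominates {ε : ℝ≥0∞} (hε1 : ε ≤ 1) (Js : List (Kernel (H × Ω) (H × Ω)))
    (hP : ∀ J ∈ Js, ∀ m : Measure H, (m.prod π).bind J = m.prod π)
    (hF : ∀ J ∈ Js, ∀ μ : Measure (H × Ω), (μ.bind J).map Prod.fst = μ.map Prod.fst)
    (hM : ∀ J ∈ Js, ∀ (r : Measure (H × Ω)) {C : Set (H × Ω)}, MeasurableSet C → ε * ((r.map Prod.fst).prod π) C ≤ (r.bind J) C)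
    (ρ : Measure (H × Ω)) [IsProbabilityMeasure ρ] :
    (1 - (1 - ε) ^ Js.length) • ((ρ.map Prod.fst).prod π) ≤
      Js.foldl (fun (μ : Measure (H × Ω)) (J : Kernel (H × Ω) (H × Ω)) => μ.bind J) ρ := by
  haveI : IsProbabilityMeasure (ρ.map (Prod.fst : H × Ω → H)) := Measure.isProbabilityMeasure_map measurable_fst.aemeasurable
  obtain ⟨r, hr, -⟩ := infoSchedule_split hε1 Js hP hF hM ρ
  have hc1 : (1 - ε) ^ Js.length ≤ 1 := pow_le_one₀ (zero_le) tsub_le_self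
  refine Measure.le_iff.2 fun C hC => ?_
  have h := congrArg (fun m : Measure (H × Ω) => m C) hr
  simp only [Measure.add_apply, Measure.smul_apply, smul_eq_mul] at h
  have hfin : (1 - ε) ^ Js.length * ((ρ.map Prod.fst).prod π) C ≠ ⊤ :=
    ENNReal.mul_ne_top (ne_top_of_le_ne_top ENNReal.one_ne_top hc1) (measure_ne_top _ _)
  rw [Measure.smul_apply, smul_eq_mul]
  refine (ENNReal.add_le_add_iff_right hfin).1 ?_
  rw [← add_mul, tsub_add_cancel_of_le hc1, one_mul, h]
  exact le_self_add

/-- **THE JOINT BOUND FOR A SCHEDULE**: `|ρJ₁⋯Jₙ(C) − (ρ_H ⊗ π)(C)| ≤ (1 − ε)ⁿ` for every `C ⊆ H × Ω`. [ours] -/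
theorem infoSchedule_joint_real_sub_le {ε : ℝ≥0∞} (hε1 : ε ≤ 1) (Js : List (Kernel (H × Ω) (H × Ω)))
    (hP : ∀ J ∈ Js, ∀ m : Measure H, (m.prod π).bind J = m.prod π)
    (hF : ∀ J ∈ Js, ∀ μ : Measure (H × Ω), (μ.bind J).map Prod.fst = μ.map Prod.fst)
    (hM : ∀ J ∈ Js, ∀ (r : Measure (H × Ω)) {C : Set (H × Ω)}, MeasurableSet C → ε * ((r.map Prod.fst).prod π) C ≤ (r.bind J) C)
    (ρ : Measure (H × Ω)) [IsProbabilityMeasure ρ] (C : Set (H × Ω)) :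
    |(Js.foldl (fun (μ : Measure (H × Ω)) (J : Kernel (H × Ω) (H × Ω)) => μ.bind J) ρ).real C - ((ρ.map Prod.fst).prod π).real C| ≤
      (1 - ε.toReal) ^ Js.length := by
  haveI : IsProbabilityMeasure (ρ.map (Prod.fst : H × Ω → H)) := Measure.isProbabilityMeasure_map measurable_fst.aemeasurable
  obtain ⟨r, hr, hrH⟩ := infoSchedule_split hε1 Js hP hF hM ρ
  set c : ℝ≥0∞ := (1 - ε) ^ Js.length with hc
  set P : Measure (H × Ω) := (ρ.map Prod.fst).prod π with hPdef
  set μn : Measure (H × Ω) := Js.foldl (fun (μ : Measure (H × Ω)) (J : Kernel (H × Ω) (H × Ω)) => μ.bind J) ρ with hμn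
  have hc1 : c ≤ 1 := pow_le_one₀ (zero_le) tsub_le_self
  have hctop : c ≠ ⊤ := ne_top_of_le_ne_top ENNReal.one_ne_top hc1
  have hcreal : c.toReal = (1 - ε.toReal) ^ Js.length := by
    rw [hc, ENNReal.toReal_pow, ENNReal.toReal_sub_of_le hε1 ENNReal.one_ne_top, ENNReal.toReal_one]
  have hrmass : r Set.univ = c := by
    have := congrArg (fun m : Measure H => m Set.univ) hrH
    simp only [Measure.map_apply measurable_fst MeasurableSet.univ, Set.preimage_univ, Measure.smul_apply, smul_eq_mul,
      measure_univ, mul_one] at this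
    exact this
  have h := congrArg (fun m : Measure (H × Ω) => m C) hr
  simp only [Measure.add_apply, Measure.smul_apply, smul_eq_mul] at h
  have hrC : r C ≤ c := (measure_mono (Set.subset_univ C)).trans_eq hrmass
  have hPC : P C ≤ 1 := prob_le_one
  have hμfin : μn C ≠ ⊤ := by
    refine ne_top_of_le_ne_top (ENNReal.add_ne_top.2 ⟨measure_ne_top P C, hctop⟩) ?_
    calc μn C ≤ μn C + c * P C := le_self_add
      _ = P C + r C := h
      _ ≤ P C + c := add_le_add le_rfl hrC
  have hreal := congrArg ENNReal.toReal h
  rw [ENNReal.toReal_add hμfin (ENNReal.mul_ne_top hctop (measure_ne_top _ _)), ENNReal.toReal_add (measure_ne_top _ _)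
    (ne_top_of_le_ne_top hctop hrC), ENNReal.toReal_mul, hcreal] at hreal
  have hr0 : 0 ≤ (r C).toReal := ENNReal.toReal_nonneg
  have hr1 : (r C).toReal ≤ (1 - ε.toReal) ^ Js.length := by rw [← hcreal]; exact ENNReal.toReal_mono hctop hrC
  have hP0 : 0 ≤ (P C).toReal := ENNReal.toReal_nonneg
  have hP1 : (P C).toReal ≤ 1 := by simpa using ENNReal.toReal_mono ENNReal.one_ne_top hPC
  have hcnn : 0 ≤ (1 - ε.toReal) ^ Js.length := by rw [← hcreal]; exact ENNReal.toReal_nonneg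
  rw [measureReal_def, measureReal_def, abs_le]
  constructor <;> nlinarith

/-- **… FOR THE CONFIGURATION**: `|ρJ₁⋯Jₙ(H × B) − π(B)| ≤ (1 − ε)ⁿ`. [ours] -/
theorem infoSchedule_config_real_sub_le {ε : ℝ≥0∞} (hε1 : ε ≤ 1) (Js : List (Kernel (H × Ω) (H × Ω)))
    (hP : ∀ J ∈ Js, ∀ m : Measure H, (m.prod π).bind J = m.prod π)
    (hF : ∀ J ∈ Js, ∀ μ : Measure (H × Ω), (μ.bind J).map Prod.fst = μ.map Prod.fst)
    (hM : ∀ J ∈ Js, ∀ (r : Measure (H × Ω)) {C : Set (H × Ω)}, MeasurableSet C → ε * ((r.map Prod.fst).prod π) C ≤ (r.bind J) C)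
    (ρ : Measure (H × Ω)) [IsProbabilityMeasure ρ] (B : Set Ω) :
    |(Js.foldl (fun (μ : Measure (H × Ω)) (J : Kernel (H × Ω) (H × Ω)) => μ.bind J) ρ).real (Set.univ ×ˢ B) - π.real B| ≤
      (1 - ε.toReal) ^ Js.length := by
  haveI : IsProbabilityMeasure (ρ.map (Prod.fst : H × Ω → H)) := Measure.isProbabilityMeasure_map measurable_fst.aemeasurable
  have h := infoSchedule_joint_real_sub_le hε1 Js hP hF hM ρ (Set.univ ×ˢ B)
  rwa [measureReal_def ((ρ.map Prod.fst).prod π), Measure.prod_prod, measure_univ, one_mul, ← measureReal_def] at h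

/-! ## §4 The lag theorem for flow samplers with varying training rules -/

/-- **THE LAG THEOREM**: a flow sampler `κ : Kernel (H' × Ω) Ω` with `π`-exact `ε`-Doeblin sections (`ε ≤ 1`); measurable training rules
`Gs : List (H → H')` applied to the lag-horizon information `I` give the parameters of the `n = |Gs|` updates; `J G` any kernel realising the
information-frozen step with parameters `G(I)`; then from ANY joint law `ρ` of `(I, x)`: the configuration after the `n` updates is within `(1 − ε)ⁿ`
of `π` on every set. [ours] -/
theorem laggedTraining_config_real_sub_le {H' : Type*} [MeasurableSpace H'] (κ : Kernel (H' × Ω) Ω) [IsMarkovKernel κ]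
    (hκ : ∀ (h : H') {B : Set Ω}, MeasurableSet B → ∫⁻ x, κ (h, x) B ∂π = π B) {ε : ℝ≥0∞}
    (hmin : ∀ (h : H') (x : Ω) {B : Set Ω}, MeasurableSet B → ε * π B ≤ κ (h, x) B) (hε1 : ε ≤ 1)
    (Gs : List (H → H')) (hG : ∀ G ∈ Gs, Measurable G) (J : (H → H') → Kernel (H × Ω) (H × Ω))
    (hJ : ∀ G ∈ Gs, ∀ (I : H) (x : Ω) {C : Set (H × Ω)}, MeasurableSet C → J G (I, x) C = κ (G I, x) ((fun y => (I, y)) ⁻¹' C))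
    (ρ : Measure (H × Ω)) [IsProbabilityMeasure ρ] (B : Set Ω) :
    |((Gs.map J).foldl (fun (μ : Measure (H × Ω)) (J : Kernel (H × Ω) (H × Ω)) => μ.bind J) ρ).real (Set.univ ×ˢ B) - π.real B| ≤
      (1 - ε.toReal) ^ Gs.length := by
  have hlen : (Gs.map J).length = Gs.length := List.length_map _
  rw [← hlen]
  have hprops : ∀ G ∈ Gs, _ := fun G hG' => frozenInfoStep_props κ hκ hmin (hG G hG') (J G) (hJ G hG')
  refine infoSchedule_config_real_sub_le hε1 (Gs.map J) (fun K hK => ?_) (fun K hK => ?_) (fun K hK => ?_) ρ B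
  · obtain ⟨G, hG', rfl⟩ := List.mem_map.1 hK; exact (hprops G hG').1
  · obtain ⟨G, hG', rfl⟩ := List.mem_map.1 hK; exact (hprops G hG').2.1
  · obtain ⟨G, hG', rfl⟩ := List.mem_map.1 hK; exact (hprops G hG').2.2

end Summit.Ventures.LatticeQCDFlow.Exactness
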